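import Mathlib.Analysis.CStarAlgebra.Matrix
import Mathlib.Analysis.InnerProductSpace.PiL2
import Mathlib.Analysis.InnerProductSpace.Calculus
import Mathlib.Analysis.SpecialFunctions.SmoothTransition
import Mathlib.Analysis.SpecialFunctions.Trigonometric.Deriv
import HarnessLib

/-!
# The model `1`-handle read on `ℝ⁴`: longitudinal and fibre coordinates, the solid cylinder,
# fibre rotations and the twist map `R_m`

Topic `Literature/Topology/FourManifolds`.  Elementary coordinate book-keeping for the uniqueness
of `1`-handles along a common core up to the fibre twist
(`Literature.Topology.FourManifolds.oneHandle_ambientIsotopic_upToTwist`, `OneHandleUniqueness.lean`;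
Hirsch, *Differential Topology* (1976), Ch. 4 §5, Thm. 5.3 with Ch. 8 §1, Thm. 1.3), which reads a
`1`-handle of a `4`-manifold on the solid cylinder
`T = {p : |p₀| ≤ 1, p₁² + p₂² + p₃² ≤ 1} ⊆ ℝ⁴` with longitudinal coordinate `p₀` and fibre
`(p₁, p₂, p₃)`.  Everything here is an explicit definition with its `simp` lemmas, or proved.

* `OneHandle.lon`, `OneHandle.fib`, `OneHandle.emb`, `OneHandle.e0`, `OneHandle.mk` — the
  longitudinal coordinate `ℝ⁴ →L ℝ`, the fibre coordinate `ℝ⁴ →L ℝ³`, the fibre inclusion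
  `ℝ³ →L ℝ⁴`, the core direction and the recombination `mk x v = (x, v)`;
* `OneHandle.solidCyl` — the solid cylinder `T` (compact), with the bridge
  `OneHandle.mem_solidCyl_iff` to the coordinate description of the named fact;
* `OneHandle.rotMat3`, `OneHandle.rot` — the rotation of the fibre `ℝ³` about its first axis
  through the angle `θ` (a matrix and the operator `Matrix.toEuclideanCLM` of it), an isometry,
  a one-parameter group, smooth in `θ`;
* `OneHandle.twistAngle m x = 2π m χ(x + 1/2)` (`χ = Real.smoothTransition`) and the **twist map**
  `OneHandle.twistMap m p = (p₀, rot (twistAngle m p₀) (p₁, p₂, p₃))` — the representative `R_m`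
  of the class `m mod 2 ∈ π₁(SO(3)) = ℤ/2` used in the named fact (`twistMap_eq` is its
  coordinate formula verbatim); `R_m = id` for `|p₀| ≥ 1/2`, `R_m` preserves `T` and the fibre
  norm.

## References

* M. W. Hirsch, *Differential Topology*, GTM 33, Springer (1976), Ch. 4 §5, Thm. 5.3; Ch. 8 §1,
  Thm. 1.3. [Hirsch1976]
* R. E. Gompf, A. I. Stipsicz, *4-Manifolds and Kirby Calculus*, GSM 20 (1999), §5.2 (the two
  framings of a circle, `π₁ SO(3) = ℤ/2`). [GompfStipsiczGSM1999]
-/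

noncomputable section

open Set Function Metric Real
open scoped ContDiff Topology

namespace Literature.Topology.FourManifolds

namespace OneHandle

/-- Local notation: `𝔼 n` is the model Euclidean space `EuclideanSpace ℝ (Fin n)`. -/
local notation "𝔼 " n:arg => EuclideanSpace ℝ (Fin n)

/-! ### Coordinates -/

/-- The **longitudinal coordinate** `p ↦ p₀` of `ℝ⁴`, a continuous linear form. [folklore] -/
def lon : 𝔼 4 →L[ℝ] ℝ := EuclideanSpace.proj (0 : Fin 4)

/-- The **fibre coordinate** `p ↦ (p₁, p₂, p₃)` of `ℝ⁴`, a continuous linear map onto `ℝ³`.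
[folklore] -/
def fib : 𝔼 4 →L[ℝ] 𝔼 3 :=
  LinearMap.toContinuousLinearMap
    { toFun := fun p => WithLp.toLp 2 fun i : Fin 3 => p i.succ
      map_add' := fun p q => by ext i; simp
      map_smul' := fun c p => by ext i; simp }

/-- The **fibre inclusion** `v ↦ (0, v₀, v₁, v₂)` of `ℝ³` in `ℝ⁴`. [folklore] -/
def emb : 𝔼 3 →L[ℝ] 𝔼 4 :=
  LinearMap.toContinuousLinearMap
    { toFun := fun v => WithLp.toLp 2 (Fin.cons 0 fun i : Fin 3 => v i : Fin 4 → ℝ)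
      map_add' := fun v w => by
        ext i; refine Fin.cases ?_ (fun j => ?_) i <;> simp
      map_smul' := fun c v => by
        ext i; refine Fin.cases ?_ (fun j => ?_) i <;> simp }

/-- The **core direction** `e₀ = (1, 0, 0, 0)`. [folklore] -/
def e0 : 𝔼 4 := EuclideanSpace.single (0 : Fin 4) (1 : ℝ)

/-- Recombination of a longitudinal and a fibre coordinate: `mk x v = (x, v₀, v₁, v₂)`.
[folklore] -/
def mk (x : ℝ) (v : 𝔼 3) : 𝔼 4 := x • e0 + emb v

/-- The longitudinal coordinate is `p₀`. [folklore] -/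
@[simp] theorem lon_apply (p : 𝔼 4) : lon p = p 0 := rfl

/-- The coordinates of the fibre coordinate are `p₁, p₂, p₃`. [folklore] -/
@[simp] theorem fib_apply (p : 𝔼 4) (i : Fin 3) : fib p i = p i.succ := rfl

/-- The fibre inclusion has vanishing longitudinal coordinate. [folklore] -/
@[simp] theorem emb_apply_zero (v : 𝔼 3) : emb v 0 = 0 := rfl

/-- The fibre inclusion copies the fibre coordinates. [folklore] -/
@[simp] theorem emb_apply_succ (v : 𝔼 3) (i : Fin 3) : emb v i.succ = v i := by
  simp [emb]

/-- The coordinates of `e₀ = (1, 0, 0, 0)`. [folklore] -/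
@[simp] theorem e0_apply_eq_ite (i : Fin 4) : e0 i = if i = 0 then 1 else 0 := by
  fin_cases i <;> simp [e0]

/-- `e₀` has vanishing fibre coordinates. [folklore] -/
@[simp] theorem e0_apply_succ (i : Fin 3) : e0 i.succ = 0 := by
  simp [e0, Fin.succ_ne_zero]

/-- `(mk x v)₀ = x`. [folklore] -/
@[simp] theorem mk_apply_zero (x : ℝ) (v : 𝔼 3) : mk x v 0 = x := by simp [mk]

/-- `(mk x v)ᵢ₊₁ = vᵢ`. [folklore] -/
@[simp] theorem mk_apply_succ (x : ℝ) (v : 𝔼 3) (i : Fin 3) : mk x v i.succ = v i := by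
  simp [mk]

/-- `mk x v = (x, v₀, v₁, v₂)` in the vector notation of the named fact. [folklore] -/
theorem mk_eq (x : ℝ) (v : 𝔼 3) : mk x v = !₂[x, v 0, v 1, v 2] := by
  ext i
  refine Fin.cases ?_ (fun j => ?_) i
  · simp
  · rw [mk_apply_succ]
    fin_cases j <;> rfl

/-- `lon (mk x v) = x`. [folklore] -/
@[simp] theorem lon_mk (x : ℝ) (v : 𝔼 3) : lon (mk x v) = x := mk_apply_zero x v

/-- `fib (mk x v) = v`. [folklore] -/
@[simp] theorem fib_mk (x : ℝ) (v : 𝔼 3) : fib (mk x v) = v := by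
  ext i; simp

/-- A point is recombined from its two coordinates. [folklore] -/
@[simp] theorem mk_lon_fib (p : 𝔼 4) : mk (lon p) (fib p) = p := by
  ext i
  refine Fin.cases ?_ (fun j => ?_) i <;> simp

/-- `lon ∘ emb = 0`. [folklore] -/
@[simp] theorem lon_emb (v : 𝔼 3) : lon (emb v) = 0 := rfl

/-- `fib ∘ emb = id`. [folklore] -/
@[simp] theorem fib_emb (v : 𝔼 3) : fib (emb v) = v := by ext i; simp

/-- `lon e₀ = 1`. [folklore] -/
@[simp] theorem lon_e0 : lon e0 = 1 := by simp

/-- `fib e₀ = 0`. [folklore] -/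
@[simp] theorem fib_e0 : fib e0 = 0 := by ext i; simp

/-- `mk x 0 = x • e₀`. [folklore] -/
theorem mk_zero_right (x : ℝ) : mk x 0 = x • e0 := by simp [mk]

/-- Adding a fibre vector: `mk x v + emb w = mk x (v + w)`. [folklore] -/
theorem mk_add_emb (x : ℝ) (v w : 𝔼 3) : mk x v + emb w = mk x (v + w) := by
  simp [mk, add_assoc]

/-- Two points with the same coordinates are equal. [folklore] -/
theorem ext_lon_fib {p q : 𝔼 4} (h1 : lon p = lon q) (h2 : fib p = fib q) : p = q := by
  rw [← mk_lon_fib p, ← mk_lon_fib q, h1, h2]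

/-- `(x, v) ↦ mk x v` is a continuous linear, hence smooth, map. [folklore] -/
theorem contDiff_mk {n : WithTop ℕ∞} : ContDiff ℝ n fun q : ℝ × 𝔼 3 => mk q.1 q.2 :=
  (contDiff_fst.smul contDiff_const).add (emb.contDiff.comp contDiff_snd)

/-- `(x, v) ↦ mk x v` is continuous. [folklore] -/
theorem continuous_mk : Continuous fun q : ℝ × 𝔼 3 => mk q.1 q.2 :=
  (contDiff_mk (n := 0)).continuous

/-! ### Norms -/

/-- `‖(p₁, p₂, p₃)‖² = p₁² + p₂² + p₃²`. [folklore] -/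
theorem norm_fib_sq (p : 𝔼 4) : ‖fib p‖ ^ 2 = p 1 ^ 2 + p 2 ^ 2 + p 3 ^ 2 := by
  rw [EuclideanSpace.real_norm_sq_eq, Fin.sum_univ_three]
  simp [fib_apply]

/-- `‖p‖² = p₀² + ‖(p₁, p₂, p₃)‖²`. [folklore] -/
theorem norm_sq_eq (p : 𝔼 4) : ‖p‖ ^ 2 = lon p ^ 2 + ‖fib p‖ ^ 2 := by
  rw [EuclideanSpace.real_norm_sq_eq, Fin.sum_univ_four, norm_fib_sq, lon_apply]
  ring

/-- `|p₀| ≤ ‖p‖`. [folklore] -/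
theorem abs_lon_le_norm (p : 𝔼 4) : |lon p| ≤ ‖p‖ := by
  have h := norm_sq_eq p
  nlinarith [norm_nonneg p, abs_nonneg (lon p), sq_abs (lon p), norm_nonneg (fib p)]

/-- `‖(p₁, p₂, p₃)‖ ≤ ‖p‖`. [folklore] -/
theorem norm_fib_le_norm (p : 𝔼 4) : ‖fib p‖ ≤ ‖p‖ := by
  have h := norm_sq_eq p
  nlinarith [norm_nonneg p, norm_nonneg (fib p), sq_nonneg (lon p)]

/-- `‖p‖ ≤ |p₀| + ‖(p₁, p₂, p₃)‖`. [folklore] -/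
theorem norm_le_abs_lon_add_norm_fib (p : 𝔼 4) : ‖p‖ ≤ |lon p| + ‖fib p‖ := by
  have h := norm_sq_eq p
  nlinarith [norm_nonneg p, abs_nonneg (lon p), sq_abs (lon p), norm_nonneg (fib p)]

/-- `‖mk x v‖ ≤ |x| + ‖v‖`. [folklore] -/
theorem norm_mk_le (x : ℝ) (v : 𝔼 3) : ‖mk x v‖ ≤ |x| + ‖v‖ := by
  simpa using norm_le_abs_lon_add_norm_fib (mk x v)

/-! ### The solid cylinder -/

/-- The **solid cylinder** `T = {p : |p₀| ≤ 1, ‖(p₁, p₂, p₃)‖ ≤ 1}` on which a `1`-handle is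
read. [cite: Hirsch1976, Ch. 4 §5] -/
def solidCyl : Set (𝔼 4) := {p | |lon p| ≤ 1 ∧ ‖fib p‖ ≤ 1}

/-- Membership in the solid cylinder (definitional). [folklore] -/
theorem mem_solidCyl {p : 𝔼 4} : p ∈ solidCyl ↔ |lon p| ≤ 1 ∧ ‖fib p‖ ≤ 1 := Iff.rfl

/-- Bridge to the coordinate description used in the named fact. [folklore] -/
theorem mem_solidCyl_iff (p : 𝔼 4) :
    p ∈ solidCyl ↔ |p 0| ≤ 1 ∧ p 1 ^ 2 + p 2 ^ 2 + p 3 ^ 2 ≤ 1 := by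
  rw [mem_solidCyl, lon_apply, ← norm_fib_sq]
  constructor
  · rintro ⟨h1, h2⟩
    exact ⟨h1, by nlinarith [norm_nonneg (fib p)]⟩
  · rintro ⟨h1, h2⟩
    exact ⟨h1, by nlinarith [norm_nonneg (fib p)]⟩

/-- The fibre-norm condition of the named fact is `‖fib p‖ ≤ 1`. [folklore] -/
theorem norm_fib_le_one_iff (p : 𝔼 4) : ‖fib p‖ ≤ 1 ↔ p 1 ^ 2 + p 2 ^ 2 + p 3 ^ 2 ≤ 1 := by
  rw [← norm_fib_sq]
  constructor <;> intro h <;> nlinarith [norm_nonneg (fib p)]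

/-- The solid cylinder is closed. [folklore] -/
theorem isClosed_solidCyl : IsClosed solidCyl :=
  (isClosed_le (continuous_abs.comp lon.continuous) continuous_const).inter
    (isClosed_le (continuous_norm.comp fib.continuous) continuous_const)

/-- The solid cylinder is bounded. [folklore] -/
theorem solidCyl_subset_closedBall : solidCyl ⊆ closedBall (0 : 𝔼 4) 2 := fun p hp => by
  rw [mem_closedBall, dist_zero_right]
  linarith [norm_le_abs_lon_add_norm_fib p, hp.1, hp.2]

/-- The solid cylinder is compact. [folklore] -/
theorem isCompact_solidCyl : IsCompact solidCyl :=
  (isCompact_closedBall (0 : 𝔼 4) 2).of_isClosed_subset isClosed_solidCyl solidCyl_subset_closedBall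

/-! ### Rotations of the fibre about its first axis -/

/-- The matrix of the rotation of `ℝ³` about the first axis through the angle `θ`. [folklore] -/
def rotMat3 (θ : ℝ) : Matrix (Fin 3) (Fin 3) ℝ :=
  !![1, 0, 0; 0, Real.cos θ, -Real.sin θ; 0, Real.sin θ, Real.cos θ]

/-- Constant part of `rotMat3`. [folklore] -/
def baseMat : Matrix (Fin 3) (Fin 3) ℝ := !![1, 0, 0; 0, 0, 0; 0, 0, 0]

/-- `cos`-part of `rotMat3`. [folklore] -/
def cosMat : Matrix (Fin 3) (Fin 3) ℝ := !![0, 0, 0; 0, 1, 0; 0, 0, 1]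

/-- `sin`-part of `rotMat3`. [folklore] -/
def sinMat : Matrix (Fin 3) (Fin 3) ℝ := !![0, 0, 0; 0, 0, -1; 0, 1, 0]

/-- Decomposition of the rotation matrix into its constant, `cos` and `sin` parts. [folklore] -/
theorem rotMat3_eq (θ : ℝ) : rotMat3 θ = baseMat + Real.cos θ • cosMat + Real.sin θ • sinMat := by
  ext i j
  fin_cases i <;> fin_cases j <;> simp [rotMat3, baseMat, cosMat, sinMat]

/-- The rotations form a one-parameter group: `R(a) R(b) = R(a + b)`. [folklore] -/
theorem rotMat3_mul (a b : ℝ) : rotMat3 a * rotMat3 b = rotMat3 (a + b) := by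
  ext i j
  fin_cases i <;> fin_cases j <;>
    simp [rotMat3, Matrix.mul_apply, Fin.sum_univ_three, Real.cos_add, Real.sin_add] <;> ring

/-- `R(0) = 1` (matrices). [folklore] -/
theorem rotMat3_zero : rotMat3 0 = 1 := by
  ext i j
  fin_cases i <;> fin_cases j <;> simp [rotMat3]

/-- **The rotation of the fibre `ℝ³` about its first axis through the angle `θ`**, as a
continuous linear operator (`Matrix.toEuclideanCLM` of `rotMat3 θ`). [folklore] -/
def rot (θ : ℝ) : 𝔼 3 →L[ℝ] 𝔼 3 := Matrix.toEuclideanCLM (n := Fin 3) (𝕜 := ℝ) (rotMat3 θ)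

/-- Coordinates of `rot θ v` (matrix times vector). [folklore] -/
theorem rot_apply (θ : ℝ) (v : 𝔼 3) (i : Fin 3) : rot θ v i = ∑ j, rotMat3 θ i j * v j := rfl

/-- The rotation fixes the first fibre coordinate. [folklore] -/
@[simp] theorem rot_apply_zero (θ : ℝ) (v : 𝔼 3) : rot θ v 0 = v 0 := by
  simp [rot_apply, rotMat3, Fin.sum_univ_three]

/-- Second coordinate of the rotated vector. [folklore] -/
@[simp] theorem rot_apply_one (θ : ℝ) (v : 𝔼 3) :
    rot θ v 1 = Real.cos θ * v 1 - Real.sin θ * v 2 := by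
  simp [rot_apply, rotMat3, Fin.sum_univ_three]; ring

/-- Third coordinate of the rotated vector. [folklore] -/
@[simp] theorem rot_apply_two (θ : ℝ) (v : 𝔼 3) :
    rot θ v 2 = Real.sin θ * v 1 + Real.cos θ * v 2 := by
  simp [rot_apply, rotMat3, Fin.sum_univ_three]

/-- `R(a) R(b) = R(a + b)` for the operators. [folklore] -/
theorem rot_mul (a b : ℝ) : rot a * rot b = rot (a + b) := by
  rw [rot, rot, rot, ← map_mul, rotMat3_mul]

/-- `R(θ) = 1` for `θ = 0` (operators). [folklore] -/
theorem rot_eq_one_of_eq_zero {θ : ℝ} (h : θ = 0) : rot θ = 1 := by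
  rw [h, rot, rotMat3_zero, map_one]

/-- `R(a) (R(b) v) = R(a + b) v`. [folklore] -/
theorem rot_apply_rot (a b : ℝ) (v : 𝔼 3) : rot a (rot b v) = rot (a + b) v := by
  rw [← rot_mul]; rfl

/-- `R(-a) (R(a) v) = v`. [folklore] -/
theorem rot_neg_apply_rot (a : ℝ) (v : 𝔼 3) : rot (-a) (rot a v) = v := by
  rw [rot_apply_rot, rot_eq_one_of_eq_zero (neg_add_cancel a)]; rfl

/-- `R(a) (R(-a) v) = v`. [folklore] -/
theorem rot_apply_rot_neg (a : ℝ) (v : 𝔼 3) : rot a (rot (-a) v) = v := by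
  rw [rot_apply_rot, rot_eq_one_of_eq_zero (add_neg_cancel a)]; rfl

/-- Each rotation is invertible, with inverse the opposite rotation. [folklore] -/
theorem isUnit_rot (θ : ℝ) : IsUnit (rot θ) :=
  ⟨⟨rot θ, rot (-θ), by rw [rot_mul, rot_eq_one_of_eq_zero (add_neg_cancel θ)],
    by rw [rot_mul, rot_eq_one_of_eq_zero (neg_add_cancel θ)]⟩, rfl⟩

/-- A full turn is the identity: `R(2π m) = 1` for `m ∈ ℤ`. [folklore] -/
theorem rot_int_mul_two_pi (m : ℤ) : rot (2 * π * m) = 1 := by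
  have hc : Real.cos (2 * π * m) = 1 := by
    rw [show 2 * π * (m : ℝ) = (m : ℝ) * (2 * π) by ring]; exact Real.cos_int_mul_two_pi m
  have hs : Real.sin (2 * π * m) = 0 := by
    have h := Real.sin_periodic.int_mul m 0
    rw [zero_add, Real.sin_zero] at h
    rw [show 2 * π * (m : ℝ) = (m : ℝ) * (2 * π) by ring]; exact h
  have : rotMat3 (2 * π * m) = 1 := by
    ext i j
    fin_cases i <;> fin_cases j <;> simp [rotMat3, hc, hs]
  rw [rot, this, map_one]

/-- **Rotations preserve the norm of the fibre.** [folklore] -/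
theorem norm_rot (θ : ℝ) (v : 𝔼 3) : ‖rot θ v‖ = ‖v‖ := by
  have h : ‖rot θ v‖ ^ 2 = ‖v‖ ^ 2 := by
    rw [EuclideanSpace.real_norm_sq_eq, EuclideanSpace.real_norm_sq_eq, Fin.sum_univ_three,
      Fin.sum_univ_three, rot_apply_zero, rot_apply_one, rot_apply_two]
    nlinarith [Real.sin_sq_add_cos_sq θ]
  nlinarith [norm_nonneg (rot θ v), norm_nonneg v]

/-- The rotation operator as a combination of three fixed operators with the coefficients
`1, cos θ, sin θ`. [folklore] -/
theorem rot_eq (θ : ℝ) : rot θ = Matrix.toEuclideanCLM (n := Fin 3) (𝕜 := ℝ) baseMat +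
    Real.cos θ • Matrix.toEuclideanCLM (n := Fin 3) (𝕜 := ℝ) cosMat +
    Real.sin θ • Matrix.toEuclideanCLM (n := Fin 3) (𝕜 := ℝ) sinMat := by
  rw [rot, rotMat3_eq, map_add, map_add, map_smul, map_smul]

/-- **The rotation operator depends smoothly on the angle.** [folklore] -/
theorem contDiff_rot {n : WithTop ℕ∞} : ContDiff ℝ n rot := by
  have h : rot = fun θ => Matrix.toEuclideanCLM (n := Fin 3) (𝕜 := ℝ) baseMat +
      Real.cos θ • Matrix.toEuclideanCLM (n := Fin 3) (𝕜 := ℝ) cosMat +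
      Real.sin θ • Matrix.toEuclideanCLM (n := Fin 3) (𝕜 := ℝ) sinMat := funext rot_eq
  rw [h]
  exact (contDiff_const.add (Real.contDiff_cos.smul contDiff_const)).add
    (Real.contDiff_sin.smul contDiff_const)

/-! ### The twist angle and the twist map `R_m` -/

/-- The **twist angle** `2π m χ(x + 1/2)`, `χ = Real.smoothTransition`: `0` for `x ≤ -1/2`,
`2π m` for `x ≥ 1/2`, smooth and monotone in between. [cite: Hirsch1976, Ch. 4 §5, Thm. 5.3] -/
def twistAngle (m : ℤ) (x : ℝ) : ℝ := 2 * Real.pi * (m : ℝ) * Real.smoothTransition (x + 1 / 2)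

/-- The twist angle is smooth. [folklore] -/
theorem contDiff_twistAngle (m : ℤ) : ContDiff ℝ ∞ (twistAngle m) := by
  have h : ContDiff ℝ ∞ fun x : ℝ => x + 1 / 2 := contDiff_id.add contDiff_const
  exact contDiff_const.mul (Real.smoothTransition.contDiff.comp h)

/-- The twist angle vanishes for `x ≤ -1/2`. [folklore] -/
theorem twistAngle_of_le {m : ℤ} {x : ℝ} (hx : x ≤ -(1 / 2)) : twistAngle m x = 0 := by
  rw [twistAngle, Real.smoothTransition.zero_of_nonpos (by linarith), mul_zero]

/-- The twist angle is `2π m` for `x ≥ 1/2`. [folklore] -/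
theorem twistAngle_of_ge {m : ℤ} {x : ℝ} (hx : 1 / 2 ≤ x) : twistAngle m x = 2 * π * m := by
  rw [twistAngle, Real.smoothTransition.one_of_one_le (by linarith), mul_one]

/-- Off `|x| < 1/2` the twist rotation is the identity. [folklore] -/
theorem rot_twistAngle_of_half_le_abs {m : ℤ} {x : ℝ} (hx : 1 / 2 ≤ |x|) :
    rot (twistAngle m x) = 1 := by
  rcases le_or_gt 0 x with h | h
  · rw [abs_of_nonneg h] at hx
    rw [twistAngle_of_ge hx, rot_int_mul_two_pi]
  · rw [abs_of_neg h] at hx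
    rw [twistAngle_of_le (by linarith), rot_eq_one_of_eq_zero rfl]

/-- **The twist map `R_m`**: rotate the fibre `(p₁, p₂, p₃)` about its first axis through the
angle `2π m χ(p₀ + 1/2)`.  For odd `m` the loop `p₀ ↦ rot (twistAngle m p₀)` is the standard
generator of `π₁ SO(3) = ℤ/2` (Gompf–Stipsicz §5.2). [cite: Hirsch1976, Ch. 4 §5, Thm. 5.3] -/
def twistMap (m : ℤ) (p : 𝔼 4) : 𝔼 4 := mk (lon p) (rot (twistAngle m (lon p)) (fib p))

/-- The twist map preserves the longitudinal coordinate. [folklore] -/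
@[simp] theorem lon_twistMap (m : ℤ) (p : 𝔼 4) : lon (twistMap m p) = lon p := by
  simp [twistMap]

/-- The fibre coordinate of the twist map is the rotated fibre. [folklore] -/
@[simp] theorem fib_twistMap (m : ℤ) (p : 𝔼 4) :
    fib (twistMap m p) = rot (twistAngle m (lon p)) (fib p) := by
  simp [twistMap]

/-- The twist map preserves the fibre norm. [folklore] -/
theorem norm_fib_twistMap (m : ℤ) (p : 𝔼 4) : ‖fib (twistMap m p)‖ = ‖fib p‖ := by
  rw [fib_twistMap, norm_rot]

/-- The twist map preserves the solid cylinder. [folklore] -/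
theorem twistMap_mem_solidCyl {m : ℤ} {p : 𝔼 4} (hp : p ∈ solidCyl) : twistMap m p ∈ solidCyl :=
  ⟨by rw [lon_twistMap]; exact hp.1, by rw [norm_fib_twistMap]; exact hp.2⟩

/-- Off `|p₀| < 1/2` the twist map is the identity. [folklore] -/
theorem twistMap_eq_self_of_half_le {m : ℤ} {p : 𝔼 4} (hp : 1 / 2 ≤ |lon p|) :
    twistMap m p = p := by
  rw [twistMap, rot_twistAngle_of_half_le_abs hp]
  exact mk_lon_fib p

/-- `R_0 = id`. [folklore] -/
theorem twistMap_zero (p : 𝔼 4) : twistMap 0 p = p := by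
  rw [twistMap, twistAngle, Int.cast_zero, mul_zero, zero_mul, rot_eq_one_of_eq_zero rfl]
  exact mk_lon_fib p

/-- The twist map is smooth. [folklore] -/
theorem contDiff_twistMap (m : ℤ) : ContDiff ℝ ∞ (twistMap m) := by
  have h1 : ContDiff ℝ ∞ fun p : 𝔼 4 => rot (twistAngle m (lon p)) (fib p) :=
    ((contDiff_rot.comp ((contDiff_twistAngle m).comp lon.contDiff)).clm_apply fib.contDiff)
  exact contDiff_mk.comp (lon.contDiff.prodMk h1)

/-- **The twist map in coordinates**: the formula of the named fact
`Literature.Topology.FourManifolds.oneHandle_ambientIsotopic_upToTwist`. [folklore] -/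
theorem twistMap_eq (m : ℤ) (p : 𝔼 4) : twistMap m p = !₂[p 0, p 1,
    Real.cos (2 * Real.pi * (m : ℝ) * Real.smoothTransition (p 0 + 1 / 2)) * p 2 -
      Real.sin (2 * Real.pi * (m : ℝ) * Real.smoothTransition (p 0 + 1 / 2)) * p 3,
    Real.sin (2 * Real.pi * (m : ℝ) * Real.smoothTransition (p 0 + 1 / 2)) * p 2 +
      Real.cos (2 * Real.pi * (m : ℝ) * Real.smoothTransition (p 0 + 1 / 2)) * p 3] := by
  rw [twistMap, mk_eq]
  simp only [lon_apply, rot_apply_zero, rot_apply_one, rot_apply_two, fib_apply, twistAngle]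
  rfl

end OneHandle

end Literature.Topology.FourManifolds

end
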